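import Summits.BirchSwinnertonDyer.BirchSwinnertonDyer.Theorems.KimAtThreeFineKatoPerFactorDefinedTwist
import Summits.BirchSwinnertonDyer.BirchSwinnertonDyer.Theorems.KimAtThreeFineKatoSemiLocalAssemblyCrux
import HarnessLib

/-!
# Crux `KatoKuriharaPortThreeShared` (stmt-BirchSwinnertonDyer-19560) BY NAME from the displayed per-factor
# DEFINED-`exp*` package with the TWISTED definitional clause, `hKdefσ`
# (cell `bsd-addord`, seat w2-acc5 gen 5; route W2 `KimAtThreeKolyvagin`; `--supports 19560`, helper; the LEAD
# kim3 assembles)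

HONEST FRAMING. ONE theorem, no definition, no named fact, no `sorry`; `hKdefσ` is a DISPLAYED hypothesis, so
nothing is closed; nothing is booked; BSD is not proved.  It records the crux's residual in the kernel in the
form Kato 2004 + [BK90] can honestly supply: **19560 ⟸ ⟨C1⟩ ⟸ hKloc ⟸ hKdefσ**
(`KimAtThreeFineKatoPerFactorDefinedTwist`'s docstring: the LEAD's `hKdef` VERBATIM plus a displayed twist
family `ς : v₀.Extension(𝓞 L) → Γ_ℚ`, with (DEF_w^σ) «`[φ''] = conjMap _ U (ς w) 1 y → (ψT = φ'' ∘ t_w) →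
Ψ (Λ 0 r y)_w = φ'_w [ψT]`» in place of the untwisted (DEF_w), which pins a `Λ` reading ONE place at every
factor — finding of record HOME STATUS 2026-08-27 ≈05:45Z).  The composition is
`perFactorKatoPackage_of_perFactorDefinedTwist` ∘ kim3's `katoKuriharaPortThreeShared_of_perFactorKatoPackage`
(p497208) (∘ `fineKato_of_perFactorKatoPackage` p496573 ∘ w2-c3's p471554).  Lives in the route file's
import cone by necessity (it concludes the crux by name); sibling of kim3's `KimAtThreeFineKatoPerFactorDefinedCrux`.
-/

noncomputable section

-- the cell's Theorems namespace `Summit.BirchSwinnertonDyer.BirchSwinnertonDyer.…` repeats the summit name by design (D-0017)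
set_option linter.dupNamespace false

open scoped Classical NumberField TensorProduct ContRepresentation
open Field NumberField IsDedekindDomain
open WeierstrassCurve Literature.NumberTheory.EllipticCurves Literature.NumberTheory.GaloisRepresentations
  Literature.NumberTheory.GaloisRepresentations.DiscreteGaloisModule Literature.NumberTheory.GaloisCohomology
open Literature.NumberTheory.EllipticCurves.ModularForms Literature.NumberTheory.EllipticCurves.Rank1Residual
open Literature.NumberTheory.EllipticCurves.Kato2004 Literature.NumberTheory.EllipticCurves.Kato2004.EulerSystemValues
open Literature.NumberTheory.AdelicBaseChange
open Summit.BirchSwinnertonDyer.Rank1Residual.GaloisImage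
open Summit.BirchSwinnertonDyer.Rank1Residual.Additive.LocalLog
open Summit.BirchSwinnertonDyer.BirchSwinnertonDyer.Theorems
open Summit.BirchSwinnertonDyer.BirchSwinnertonDyer.Theorems.KimAtThreeFineKatoPerFactorDefined
open Summit.BirchSwinnertonDyer.BirchSwinnertonDyer.Theorems.KimAtThreeFineKatoPerFactorDefinedTwist

namespace Summit.BirchSwinnertonDyer.BirchSwinnertonDyer.Theorems.KimAtThreeFineKatoPerFactorDefinedTwistCrux

/-- **Crux `KatoKuriharaPortThreeShared` BY NAME from the displayed per-factor DEFINED-`exp*` package with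
the TWISTED definitional clause, `hKdefσ`** (`perFactorKatoPackage_of_perFactorDefinedTwist`, then kim3's
`katoKuriharaPortThreeShared_of_perFactorKatoPackage`).  `hKdefσ` displayed — NOT a closing theorem.
[cite: Kato2004Asterisque, (8.1.3) (p. 180), Prop. 8.12 (p. 186), §9.4 and Thm. 9.7 (pp. 188–189), Thm. 6.6 (1) (p. 163), Ex. 13.3 (pp. 224–225)]
[cite: BlochKato1990, §3 (Prop. 3.8, Ex. 3.11)] [cite: Kim2022StructureSelmer, §3.3–§3.4.1 and Thm. 3.13]
[cite: MazurRubin2004, Thm. 3.2.4 and App. A Remark A.5] [cite: SerreLocalFields1979, VII §5 Prop. 3] -/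
theorem katoKuriharaPortThreeShared_of_perFactorDefinedTwist
    (hKdefσ : ∀ (W : WeierstrassCurve ℚ) [W.IsElliptic] [W.IsGloballyMinimal]
      [ContinuousSMul ℤ_[3] (W.tateModule 3)] [Module.Free ℤ_[3] (W.tateModule 3)]
      [Module.Finite ℤ_[3] (W.tateModule 3)],
      (∀ m : ℕ, W.HasSurjectiveModNGaloisRep (3 ^ m : ℕ)) →
      (haveI : Fact (Nat.Prime 3) := ⟨Nat.prime_three⟩; Addv W 3) →
      ¬ 3 ∣ (W.baseChange ℚ_[3]).localTamagawaNumber ℤ_[3] →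
      Nat.card {Q : (W.baseChange ℚ_[3]).toAffine.Point // (3 : ℕ) • Q = 0} = 1 →
      ∀ {N : ℕ} [NeZero N] (P : ModularParametrizationData W N), N = W.conductorNorm ℤ →
        (∀ z ∈ P.L.lattice, ∃ w ∈ periodLattice P.f, z = P.c * w) →
        ¬ (3 : ℤ) ∣ P.maninConstant →
        ∃ (ι : (n : ℕ) → (CyclotomicField n ℚ →+* ℂ)) (κK : ℝ)
          (Λ : ∀ (k' : ℕ) (r : Finset (HeightOneSpectrum (𝓞 ℚ))),
            H1 (tateRep W 3) (cycSubgroup 3 k' r) →ₗ[ℤ_[3]]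
              ℚ_[3] ⊗[ℚ] CyclotomicField (cycLevel 3 k' r) ℚ)
          (φ : (tateLocalRep W 3 (Sum.inr ((Rat.HeightOneSpectrum.primesEquiv (R := 𝓞 ℚ)).symm ⟨3, Fact.out⟩))).cohomology 1 →+ ℚ_[3]),
          κK ≠ 0 ∧ (∃ u : ℚ, (u : ℝ) = κK ∧ padicValRat 3 u = 0) ∧
          (∀ y, φ y = 0 ↔ ∀ j : ℕ, tateLocalMap W 3 j (Sum.inr ((Rat.HeightOneSpectrum.primesEquiv (R := 𝓞 ℚ)).symm ⟨3, Fact.out⟩)) y ∈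
            W.kummerSelmerStructure (((3 : ℕ) : ℤ) ^ j * ((3 : ℕ) : ℤ)) (Sum.inr ((Rat.HeightOneSpectrum.primesEquiv (R := 𝓞 ℚ)).symm ⟨3, Fact.out⟩))) ∧
          (∀ a : ℚ_[3], (∃ y, φ y = a) ↔
            ∀ Q : (W.baseChange ℚ_[3]).toAffine.Point, ‖a * padicLog (W.baseChange ℚ_[3]) Q‖ ≤ 1) ∧
          (∀ (j : ℕ) (r : Finset (HeightOneSpectrum (𝓞 ℚ)))
            (Ψ : ℚ_[3] ⊗[ℚ] CyclotomicField (cycLevel 3 0 r) ℚ ≃ₐ[ℚ]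
              (Π w : ((Rat.HeightOneSpectrum.primesEquiv (R := 𝓞 ℚ)).symm ⟨3, Fact.out⟩).Extension
                (𝓞 (CyclotomicField (cycLevel 3 0 r) ℚ)), w.1.adicCompletion (CyclotomicField (cycLevel 3 0 r) ℚ))),
            (∀ (s : ℚ_[3]) (x : CyclotomicField (cycLevel 3 0 r) ℚ)
              (w : ((Rat.HeightOneSpectrum.primesEquiv (R := 𝓞 ℚ)).symm ⟨3, Fact.out⟩).Extension
                (𝓞 (CyclotomicField (cycLevel 3 0 r) ℚ))),
              Ψ (s ⊗ₜ[ℚ] x) w =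
                algebraMap (CyclotomicField (cycLevel 3 0 r) ℚ) (w.1.adicCompletion (CyclotomicField (cycLevel 3 0 r) ℚ)) x *
                algebraMap (((Rat.HeightOneSpectrum.primesEquiv (R := 𝓞 ℚ)).symm ⟨3, Fact.out⟩).adicCompletion ℚ)
                  (w.1.adicCompletion (CyclotomicField (cycLevel 3 0 r) ℚ)) (Padic.adicCompletionEquiv (𝓞 ℚ) ⟨3, Fact.out⟩ s)) →
            ∃ (Λ₀' M' : ∀ w : ((Rat.HeightOneSpectrum.primesEquiv (R := 𝓞 ℚ)).symm ⟨3, Fact.out⟩).Extension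
                (𝓞 (CyclotomicField (cycLevel 3 0 r) ℚ)), Set (w.1.adicCompletion (CyclotomicField (cycLevel 3 0 r) ℚ)))
              (φ' : ∀ w : ((Rat.HeightOneSpectrum.primesEquiv (R := 𝓞 ℚ)).symm ⟨3, Fact.out⟩).Extension
                (𝓞 (CyclotomicField (cycLevel 3 0 r) ℚ)),
                ((tateLocalRep W 3 (Sum.inr ((Rat.HeightOneSpectrum.primesEquiv (R := 𝓞 ℚ)).symm ⟨3, Fact.out⟩))).restrict
                  (absGaloisRestrict (((Rat.HeightOneSpectrum.primesEquiv (R := 𝓞 ℚ)).symm ⟨3, Fact.out⟩).adicCompletion ℚ)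
                    (w.1.adicCompletion (CyclotomicField (cycLevel 3 0 r) ℚ)))).cohomology 1 →+ w.1.adicCompletion (CyclotomicField (cycLevel 3 0 r) ℚ))
              (ς : ((Rat.HeightOneSpectrum.primesEquiv (R := 𝓞 ℚ)).symm ⟨3, Fact.out⟩).Extension
                (𝓞 (CyclotomicField (cycLevel 3 0 r) ℚ)) → absoluteGaloisGroup ℚ),
              (∀ w, Λ₀' w ⊆ w.1.adicCompletionIntegers (CyclotomicField (cycLevel 3 0 r) ℚ)) ∧
              (∀ w, (0 : w.1.adicCompletion (CyclotomicField (cycLevel 3 0 r) ℚ)) ∈ Λ₀' w) ∧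
              (∃ w₀, ∃ ℓ₀ ∈ Λ₀' w₀, ‖(Padic.adicCompletionEquiv (𝓞 ℚ) ⟨3, Fact.out⟩).symm
                (Algebra.trace (((Rat.HeightOneSpectrum.primesEquiv (R := 𝓞 ℚ)).symm ⟨3, Fact.out⟩).adicCompletion ℚ)
                  (w₀.1.adicCompletion (CyclotomicField (cycLevel 3 0 r) ℚ)) ℓ₀)‖ = 1) ∧
              (∀ w, ∀ μ ∈ M' w, ∀ ℓ ∈ Λ₀' w, ‖(Padic.adicCompletionEquiv (𝓞 ℚ) ⟨3, Fact.out⟩).symm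
                (Algebra.trace (((Rat.HeightOneSpectrum.primesEquiv (R := 𝓞 ℚ)).symm ⟨3, Fact.out⟩).adicCompletion ℚ)
                  (w.1.adicCompletion (CyclotomicField (cycLevel 3 0 r) ℚ)) (μ * ℓ))‖ ≤ 1) ∧
              (∀ w z, φ' w z ∈ M' w) ∧
              (∀ (w : ((Rat.HeightOneSpectrum.primesEquiv (R := 𝓞 ℚ)).symm ⟨3, Fact.out⟩).Extension
                (𝓞 (CyclotomicField (cycLevel 3 0 r) ℚ)))
                (h : (tateLocalRep W 3 (Sum.inr ((Rat.HeightOneSpectrum.primesEquiv (R := 𝓞 ℚ)).symm ⟨3, Fact.out⟩))).cohomology 1),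
                φ' w (ContinuousRep.cohomologyRes (tateLocalRep W 3 (Sum.inr ((Rat.HeightOneSpectrum.primesEquiv (R := 𝓞 ℚ)).symm ⟨3, Fact.out⟩)))
                    (absGaloisRestrict (((Rat.HeightOneSpectrum.primesEquiv (R := 𝓞 ℚ)).symm ⟨3, Fact.out⟩).adicCompletion ℚ)
                      (w.1.adicCompletion (CyclotomicField (cycLevel 3 0 r) ℚ))) 1 h) =
                  algebraMap (((Rat.HeightOneSpectrum.primesEquiv (R := 𝓞 ℚ)).symm ⟨3, Fact.out⟩).adicCompletion ℚ) (w.1.adicCompletion (CyclotomicField (cycLevel 3 0 r) ℚ))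
                    (Padic.adicCompletionEquiv (𝓞 ℚ) ⟨3, Fact.out⟩ (φ h))) ∧
              (∀ (w : ((Rat.HeightOneSpectrum.primesEquiv (R := 𝓞 ℚ)).symm ⟨3, Fact.out⟩).Extension
                (𝓞 (CyclotomicField (cycLevel 3 0 r) ℚ)))
                (y : H1 (tateRep W 3) (cycSubgroup 3 0 r))
                (φ'' : contOneCocycles (subgroupRep (tateRep W 3).toTopRep (cycSubgroup 3 0 r)))
                (ψT : contOneCocycles ((tateLocalRep W 3 (Sum.inr ((Rat.HeightOneSpectrum.primesEquiv (R := 𝓞 ℚ)).symm ⟨3, Fact.out⟩))).restrict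
                    (absGaloisRestrict (((Rat.HeightOneSpectrum.primesEquiv (R := 𝓞 ℚ)).symm ⟨3, Fact.out⟩).adicCompletion ℚ)
                      (w.1.adicCompletion (CyclotomicField (cycLevel 3 0 r) ℚ)))).toTopRep),
                  oneCocycleClass _ φ'' = conjMap (tateRep W 3).toTopRep (cycSubgroup 3 0 r) (ς w) 1 y →
                  (∀ σ, ψT.1 σ = φ''.1 ⟨absGaloisRestrictTower ℚ
                      (((Rat.HeightOneSpectrum.primesEquiv (R := 𝓞 ℚ)).symm ⟨3, Fact.out⟩).adicCompletion ℚ) (w.1.adicCompletion (CyclotomicField (cycLevel 3 0 r) ℚ)) σ,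
                    absGaloisRestrictTower_adicCompletion_mem_cycSubgroup r w σ⟩) →
                  Ψ (Λ 0 r y) w = φ' w (oneCocycleClass _ ψT))) ∧
          ∀ (c d a : ℤ) (A : ℕ), 0 < A → Int.gcd c (6 * 3 * A) = 1 → Int.gcd d (6 * 3 * N) = 1 →
            ∃ (z : ∀ (k' : ℕ) (r : (cyclotomicLevelsRat 3 (badPlaces c d A N)).Ideals),
                  H1 (tateRep W 3) ((cyclotomicLevelsRat 3 (badPlaces c d A N)).level k' r.1))
              (x : ∀ (k' : ℕ) (r : (cyclotomicLevelsRat 3 (badPlaces c d A N)).Ideals),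
                  CyclotomicField (cycLevel 3 k' r.1) ℚ),
              ZetaBody W 3 P.f ι κK Λ c d a A z x) :
    Summit.BirchSwinnertonDyer.BirchSwinnertonDyer.Theses.KimAtThreeKolyvagin.KatoKuriharaPortThreeShared :=
  KimAtThreeFineKatoSemiLocalAssemblyCrux.katoKuriharaPortThreeShared_of_perFactorKatoPackage
    (perFactorKatoPackage_of_perFactorDefinedTwist hKdefσ)

end Summit.BirchSwinnertonDyer.BirchSwinnertonDyer.Theorems.KimAtThreeFineKatoPerFactorDefinedTwistCrux

end
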